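/-
  FunctionalMining / NoGo — two-notch STRICT K rule book: the SIDE-REFINED static bound (COROLLARY R₂‴ of
  COLLAPSE-ADDENDUM-4 add-1, nogo g17) — finite / real-arithmetic cores only; the kinematic layer stays prose.
  search for candidate a priori estimates; no regularity claim.

  Content.
  §A  real arithmetic: on an R-arc the skeleton level lies in {w, w+t} and on an L-arc in {w+d, w+d+t} (ADD-3 F11 / ADD-4 R₂′),
      and the full level is skeleton + U with U bounded by side-dependent extremes (ADD-4 F14); hence the full range is bounded by
      the maximum of four side combinations (`range_le_max4`).
  §B  K4′ thresholds at sizes (d,t,u) = (δ, δ−η, δ−2η), η > 0, u > 0: the case (L,R) needs ≥ 3u of U-spread, (L,L)/(R,R) need ≥ 4u,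
      (R,L) needs ≥ 5u (`lr_needs_three`, `same_side_needs_four`, `rl_needs_five`).
  §C  exhaustive enumeration of STATIC channel data (dead | live-even χ=±1 | live-odd χ=±1 per channel; closure Q_u = 0) for p = 1, 2
      blocks, by `decide`: the four spreads are ≤ 2, 3, 3, 2 (units of u), so no p ≤ 2 pattern meets any K4′ case (`bounds1`, `bounds2`,
      `no_K4prime_static_p1/p2`): K4′ proper needs p ≥ 3 blocks; for p = 3 the spreads are ≤ (4,3,3,4) (`bounds3`; 201 of the
      3 989 closed p = 3 patterns DO meet case (L,R) — stdlib script `korbit/sidebound_enum.py` of record lists them; p = 4 there too).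
-/
import Mathlib
import HarnessLib

namespace Summit.NavierStokesRegularity.FunctionalMining.TwoNotch

/-! §A. Side-refined range bound. `true` = L-arc (high side, right of a +d), `false` = R-arc (low side, right of a −d). -/

/-- top skeleton level available on a side -/
def skTop (w d t : ℝ) : Bool → ℝ
  | true => w + d + t
  | false => w + t

/-- bottom skeleton level available on a side -/
def skBot (w d : ℝ) : Bool → ℝ
  | true => w + d
  | false => w

/-- COROLLARY R₂‴ (core). Two points of one horizontal line: θ = sk + U on side s, θ' = sk' + U' on side s'; skeleton levels inside the
side windows, U below the side maximum `Up s`, U' above the side minimum `Um s'`. Then θ − θ' is at most the largest of the four side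
combinations (L,R), (L,L), (R,R), (R,L). -/
theorem range_le_max4 {w d t θ θ' sk sk' U U' : ℝ} (Up Um : Bool → ℝ) (s s' : Bool)
    (hθ : θ = sk + U) (hθ' : θ' = sk' + U')
    (hsk : sk ≤ skTop w d t s) (hsk' : skBot w d s' ≤ sk') (hU : U ≤ Up s) (hU' : Um s' ≤ U') :
    θ - θ' ≤ max (max ((d + t) + (Up true - Um false)) (t + (Up true - Um true)))
                 (max (t + (Up false - Um false)) ((t - d) + (Up false - Um true))) := by
  subst hθ hθ'
  cases s <;> cases s' <;> simp only [skTop, skBot] at hsk hsk' hU hU'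
  · -- s = R, s' = R
    exact le_trans (by linarith) (le_trans (le_max_left _ _) (le_max_right _ _))
  · -- s = R, s' = L
    exact le_trans (by linarith) (le_trans (le_max_right _ _) (le_max_right _ _))
  · -- s = L, s' = R
    exact le_trans (by linarith) (le_trans (le_max_left _ _) (le_max_left _ _))
  · -- s = L, s' = L
    exact le_trans (by linarith) (le_trans (le_max_right _ _) (le_max_left _ _))

/-- The four cases separately (as used in the text). -/
theorem range_LR {w d t sk sk' U U' ULp URm : ℝ}
    (hsk : sk ≤ w + d + t) (hsk' : w ≤ sk') (hU : U ≤ ULp) (hU' : URm ≤ U') :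
    (sk + U) - (sk' + U') ≤ (d + t) + (ULp - URm) := by linarith

/-- Range bound, configuration LL (ADD-4 add-1 §A). [ours, bookkeeping] -/
theorem range_LL {w d t sk sk' U U' ULp ULm : ℝ}
    (hsk : sk ≤ w + d + t) (hsk' : w + d ≤ sk') (hU : U ≤ ULp) (hU' : ULm ≤ U') :
    (sk + U) - (sk' + U') ≤ t + (ULp - ULm) := by linarith

/-- Range bound, configuration RR (ADD-4 add-1 §A). [ours, bookkeeping] -/
theorem range_RR {w t sk sk' U U' URp URm : ℝ}
    (hsk : sk ≤ w + t) (hsk' : w ≤ sk') (hU : U ≤ URp) (hU' : URm ≤ U') :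
    (sk + U) - (sk' + U') ≤ t + (URp - URm) := by linarith

/-- Range bound, configuration RL (ADD-4 add-1 §A). [ours, bookkeeping] -/
theorem range_RL {w d t sk sk' U U' URp ULm : ℝ}
    (hsk : sk ≤ w + t) (hsk' : w + d ≤ sk') (hU : U ≤ URp) (hU' : ULm ≤ U') :
    (sk + U) - (sk' + U') ≤ (t - d) + (URp - ULm) := by linarith

/-! §B. K4′ thresholds: sizes d = δ, t = δ − η, u = δ − 2η with η > 0 and u > 0; a rise ≥ 4δ. -/

/-- case (L,R): (d+t) + k·u ≥ 4δ forces k ≥ 3. -/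
theorem lr_needs_three {δ η : ℝ} (hη : 0 < η) (hu : 0 < δ - 2 * η) (k : ℤ)
    (h : 4 * δ ≤ (δ + (δ - η)) + (k : ℝ) * (δ - 2 * η)) : 3 ≤ k := by
  by_contra hk
  have hk2 : (k : ℝ) ≤ 2 := by exact_mod_cast (show k ≤ 2 by omega)
  have : (k : ℝ) * (δ - 2 * η) ≤ 2 * (δ - 2 * η) := by nlinarith
  linarith

/-- cases (L,L) and (R,R): t + k·u ≥ 4δ forces k ≥ 4. -/
theorem same_side_needs_four {δ η : ℝ} (hη : 0 < η) (hu : 0 < δ - 2 * η) (k : ℤ)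
    (h : 4 * δ ≤ (δ - η) + (k : ℝ) * (δ - 2 * η)) : 4 ≤ k := by
  by_contra hk
  have hk3 : (k : ℝ) ≤ 3 := by exact_mod_cast (show k ≤ 3 by omega)
  have : (k : ℝ) * (δ - 2 * η) ≤ 3 * (δ - 2 * η) := by nlinarith
  linarith

/-- case (R,L): (t − d) + k·u ≥ 4δ forces k ≥ 5. -/
theorem rl_needs_five {δ η : ℝ} (hη : 0 < η) (hu : 0 < δ - 2 * η) (k : ℤ)
    (h : 4 * δ ≤ ((δ - η) - δ) + (k : ℝ) * (δ - 2 * η)) : 5 ≤ k := by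
  by_contra hk
  have hk4 : (k : ℝ) ≤ 4 := by exact_mod_cast (show k ≤ 4 by omega)
  have : (k : ℝ) * (δ - 2 * η) ≤ 4 * (δ - 2 * η) := by nlinarith
  linarith

/-- With spreads at most (2, 3, 3, 2) units of u (the p ≤ 2 maxima of §C) every side combination is < 4δ. -/
theorem max4_lt_of_small_spreads {δ η : ℝ} (hη : 0 < η) (hu : 0 < δ - 2 * η)
    {a b c e : ℝ} (ha : a ≤ 2 * (δ - 2 * η)) (hb : b ≤ 3 * (δ - 2 * η)) (hc : c ≤ 3 * (δ - 2 * η)) (he : e ≤ 2 * (δ - 2 * η)) :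
    max (max ((δ + (δ - η)) + a) ((δ - η) + b)) (max ((δ - η) + c) (((δ - η) - δ) + e)) < 4 * δ := by
  have hδ : 0 < δ := by linarith
  refine max_lt (max_lt ?_ ?_) (max_lt ?_ ?_) <;> linarith

/-! §C. Static channel data and the exhaustive enumeration for p = 1, 2. -/

/-- state of a channel: dead (u-free), live with even careers (π = 0) and first chirality ±1, live with odd careers (π = 1) and
first chirality ±1 (ADD-4 F13 dichotomy, F14(1),(3)). -/
inductive CS
  | dead | evenP | evenM | oddP | oddM
  deriving DecidableEq, Repr

namespace CS

/-- first chirality χ_C (0 for a dead channel, immaterial) -/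
def chi : CS → ℤ
  | dead => 0 | evenP => 1 | evenM => -1 | oddP => 1 | oddM => -1

/-- career parity π_C -/
def par : CS → ℤ
  | oddP => 1 | oddM => 1 | _ => 0

/-- is the channel live (not dead)? [ours, bookkeeping] -/
def live : CS → Bool
  | dead => false | _ => true

/-- channel charges (ADD-4 F14(3)): c_R = −χπ, c_L = +χπ -/
def cR (s : CS) : ℤ := -(s.chi * s.par)
/-- channel charge c_L = +χπ (ADD-4 F14(3)). [ours, bookkeeping] -/
def cL (s : CS) : ℤ := s.chi * s.par

/-- the U-values met on a channel adjacent to a main with value V (units of u; ADD-4 F14(2)): {V} if dead, {V, V − χ} if live -/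
def vals (V : ℤ) (s : CS) : List ℤ := if s.live then [V, V - s.chi] else [V]

/-- the list of all channel states. [ours, bookkeeping] -/
def all : List CS := [dead, evenP, evenM, oddP, oddM]

/-- every channel state is in `CS.all`. [ours, bookkeeping] -/
theorem mem_all (s : CS) : s ∈ all := by cases s <;> decide

end CS

/-- maximum of a list of integers (junk `-1000` on the empty list). [ours, bookkeeping] -/
def maxL (l : List ℤ) : ℤ := l.foldr max (-1000)
/-- minimum of a list of integers (junk `1000` on the empty list). [ours, bookkeeping] -/
def minL (l : List ℤ) : ℤ := l.foldr min 1000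

/-- the four spreads (UL⁺−UR⁻, UL⁺−UL⁻, UR⁺−UR⁻, UR⁺−UL⁻) of a value configuration -/
def spreads (Lv Rv : List ℤ) : ℤ × ℤ × ℤ × ℤ :=
  (maxL Lv - minL Rv, maxL Lv - minL Lv, maxL Rv - minL Rv, maxL Rv - minL Lv)

/-- does a spread quadruple meet one of the K4′ cases (≥ 3, ≥ 4, ≥ 4, ≥ 5)? -/
def meetsK4 (q : ℤ × ℤ × ℤ × ℤ) : Bool :=
  decide (3 ≤ q.1) || decide (4 ≤ q.2.1) || decide (4 ≤ q.2.2.1) || decide (5 ≤ q.2.2.2)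

/-- are the spreads within (2, 3, 3, 2)? -/
def small (q : ℤ × ℤ × ℤ × ℤ) : Bool :=
  decide (q.1 ≤ 2) && decide (q.2.1 ≤ 3) && decide (q.2.2.1 ≤ 3) && decide (q.2.2.2 ≤ 2)

/-- p = 1: one block (L₁, R₁); closure c_R + c_L = 0; V₁ = 0. -/
def closed1 (L1 R1 : CS) : Bool := decide (R1.cR + L1.cL = 0)
/-- the four spreads of a one-block pattern (V₁ = 0). [ours, bookkeeping] -/
def spreads1 (L1 R1 : CS) : ℤ × ℤ × ℤ × ℤ := spreads (CS.vals 0 L1) (CS.vals 0 R1)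

/-- p = 2: blocks (L₁,R₁), (L₂,R₂) in cyclic order L₁ M₁ R₁ P₂ L₂ M₂ R₂ P₁; closure; V₁ = 0, V₂ = c_{R₁} + c_{L₂}. -/
def closed2 (L1 R1 L2 R2 : CS) : Bool := decide (R1.cR + L2.cL + R2.cR + L1.cL = 0)
/-- the four spreads of a two-block pattern. [ours, bookkeeping] -/
def spreads2 (L1 R1 L2 R2 : CS) : ℤ × ℤ × ℤ × ℤ :=
  let V2 := R1.cR + L2.cL
  spreads (CS.vals 0 L1 ++ CS.vals V2 L2) (CS.vals 0 R1 ++ CS.vals V2 R2)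

/-- are the spreads within (4, 3, 3, 4)? (the p = 3 maxima) -/
def small3 (q : ℤ × ℤ × ℤ × ℤ) : Bool :=
  decide (q.1 ≤ 4) && decide (q.2.1 ≤ 3) && decide (q.2.2.1 ≤ 3) && decide (q.2.2.2 ≤ 4)

/-- p = 3: blocks (L₁,R₁), (L₂,R₂), (L₃,R₃); closure; V₁ = 0, V₂ = c_{R₁} + c_{L₂}, V₃ = V₂ + c_{R₂} + c_{L₃}. -/
def closed3 (L1 R1 L2 R2 L3 R3 : CS) : Bool := decide (R1.cR + L2.cL + R2.cR + L3.cL + R3.cR + L1.cL = 0)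
/-- the four spreads of a three-block pattern. [ours, bookkeeping] -/
def spreads3 (L1 R1 L2 R2 L3 R3 : CS) : ℤ × ℤ × ℤ × ℤ :=
  let V2 := R1.cR + L2.cL
  let V3 := V2 + R2.cR + L3.cL
  spreads (CS.vals 0 L1 ++ CS.vals V2 L2 ++ CS.vals V3 L3) (CS.vals 0 R1 ++ CS.vals V2 R2 ++ CS.vals V3 R3)

/-- exhaustive enumeration, p = 3: every closed static pattern has spreads within (4,3,3,4) (`decide`). [ours, bookkeeping] -/
theorem bounds3_all :
    (CS.all.all fun L1 => CS.all.all fun R1 => CS.all.all fun L2 => CS.all.all fun R2 => CS.all.all fun L3 => CS.all.all fun R3 =>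
      (!closed3 L1 R1 L2 R2 L3 R3 || small3 (spreads3 L1 R1 L2 R2 L3 R3))) = true := by decide

/-- p = 3: every closed static pattern has spreads within (4,3,3,4): full range ≤ (d+t) + 4u on three-block orbits (some p = 3
patterns DO meet the case (L,R) — 201 of them, `korbit/sidebound_enum.py` — so three blocks are not excluded statically). -/
theorem bounds3 (L1 R1 L2 R2 L3 R3 : CS) (h : closed3 L1 R1 L2 R2 L3 R3 = true) :
    small3 (spreads3 L1 R1 L2 R2 L3 R3) = true := by
  have H := bounds3_all
  simp only [List.all_eq_true] at H
  have := H L1 (CS.mem_all _) R1 (CS.mem_all _) L2 (CS.mem_all _) R2 (CS.mem_all _) L3 (CS.mem_all _) R3 (CS.mem_all _)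
  simpa [h] using this

/-- exhaustive enumeration, p = 1 (`decide`). [ours, bookkeeping] -/
theorem bounds1_all :
    (CS.all.all fun L1 => CS.all.all fun R1 => (!closed1 L1 R1 || small (spreads1 L1 R1))) = true := by decide

/-- exhaustive enumeration, p = 2 (`decide`). [ours, bookkeeping] -/
theorem bounds2_all :
    (CS.all.all fun L1 => CS.all.all fun R1 => CS.all.all fun L2 => CS.all.all fun R2 =>
      (!closed2 L1 R1 L2 R2 || small (spreads2 L1 R1 L2 R2))) = true := by decide

/-- p = 1: every closed static pattern has spreads within (2,3,3,2). -/
theorem bounds1 (L1 R1 : CS) (h : closed1 L1 R1 = true) : small (spreads1 L1 R1) = true := by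
  have H := bounds1_all
  simp only [List.all_eq_true] at H
  have := H L1 (CS.mem_all _) R1 (CS.mem_all _)
  simpa [h] using this

/-- p = 2: every closed static pattern has spreads within (2,3,3,2). -/
theorem bounds2 (L1 R1 L2 R2 : CS) (h : closed2 L1 R1 L2 R2 = true) : small (spreads2 L1 R1 L2 R2) = true := by
  have H := bounds2_all
  simp only [List.all_eq_true] at H
  have := H L1 (CS.mem_all _) R1 (CS.mem_all _) L2 (CS.mem_all _) R2 (CS.mem_all _)
  simpa [h] using this

/-- spreads within (2,3,3,2) never meet a K4′ case. [ours, bookkeeping] -/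
theorem small_not_meets (q : ℤ × ℤ × ℤ × ℤ) (h : small q = true) : meetsK4 q = false := by
  obtain ⟨a, b, c, e⟩ := q
  simp only [small, meetsK4, Bool.and_eq_true, decide_eq_true_eq, Bool.or_eq_false_iff, decide_eq_false_iff_not, not_le] at h ⊢
  omega

/-- p = 1: no closed static pattern meets a K4′ case. -/
theorem no_K4prime_static_p1 (L1 R1 : CS) (h : closed1 L1 R1 = true) : meetsK4 (spreads1 L1 R1) = false :=
  small_not_meets _ (bounds1 L1 R1 h)

/-- p = 2: no closed static pattern meets a K4′ case — K4′ proper needs at least three blocks. -/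
theorem no_K4prime_static_p2 (L1 R1 L2 R2 : CS) (h : closed2 L1 R1 L2 R2 = true) :
    meetsK4 (spreads2 L1 R1 L2 R2) = false :=
  small_not_meets _ (bounds2 L1 R1 L2 R2 h)

/-- Geometric reading for p ≤ 2 (joins §A–§C): if the four U-spreads of a line are a·u, b·u, c·u, e·u with (a,b,c,e) `small`, the full
range bound of `range_le_max4` is < 4δ at K4′ sizes. -/
theorem range_lt_four_delta_of_small {δ η : ℝ} (hη : 0 < η) (hu : 0 < δ - 2 * η) (q : ℤ × ℤ × ℤ × ℤ) (hq : small q = true) :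
    max (max ((δ + (δ - η)) + (q.1 : ℝ) * (δ - 2 * η)) ((δ - η) + (q.2.1 : ℝ) * (δ - 2 * η)))
        (max ((δ - η) + (q.2.2.1 : ℝ) * (δ - 2 * η)) (((δ - η) - δ) + (q.2.2.2 : ℝ) * (δ - 2 * η))) < 4 * δ := by
  obtain ⟨a, b, c, e⟩ := q
  simp only [small, Bool.and_eq_true, decide_eq_true_eq] at hq
  obtain ⟨⟨⟨ha, hb⟩, hc⟩, he⟩ := hq
  have ha' : (a : ℝ) ≤ 2 := by exact_mod_cast ha
  have hb' : (b : ℝ) ≤ 3 := by exact_mod_cast hb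
  have hc' : (c : ℝ) ≤ 3 := by exact_mod_cast hc
  have he' : (e : ℝ) ≤ 2 := by exact_mod_cast he
  apply max4_lt_of_small_spreads hη hu <;> nlinarith


/-! §D. SIMPLE orbits (ADD-4 add-2): every live channel has uniform lifetime count e_C = 1 (LEMMA U), hence is odd; channel states are
then restricted to {dead, oddP, oddM}.  At p = 3 every closed simple pattern meeting a K4′ case contains a main M_i whose two channels are
(L_i, R_i) = (oddP, oddM), i.e. (c_{L_i}, c_{R_i}) = (+1, +1): BOTH channels of FRONTHOOD type (the −t's ahead chord is −u).  §E shows such a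
main is impossible when 2η k₂² < k₁² (t+u). -/

namespace CS
/-- simple-orbit channel states: dead or odd (e_C = 1 ⇒ π_C = 1). -/
def simple : CS → Bool
  | dead => true | oddP => true | oddM => true | _ => false
end CS

/-- a main both of whose channels are of FRONTHOOD type: L = oddP (χ_L = +1, c_L = +1), R = oddM (χ_R = −1, c_R = +1). -/
def ppMain (L R : CS) : Bool := decide (L = CS.oddP) && decide (R = CS.oddM)

/-- exhaustive enumeration over the simple three-block patterns (`decide`). [ours, bookkeeping] -/
theorem simple3_pp_all :
    (CS.all.all fun L1 => CS.all.all fun R1 => CS.all.all fun L2 => CS.all.all fun R2 => CS.all.all fun L3 => CS.all.all fun R3 =>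
      (!(L1.simple && R1.simple && L2.simple && R2.simple && L3.simple && R3.simple) || !closed3 L1 R1 L2 R2 L3 R3 ||
        !meetsK4 (spreads3 L1 R1 L2 R2 L3 R3) || ppMain L1 R1 || ppMain L2 R2 || ppMain L3 R3)) = true := by decide

/-- p = 3, simple orbits: a closed static pattern meeting a K4′ case has a main with (L_i, R_i) = (oddP, oddM) — both channels of
FRONTHOOD type (exhaustive over the 3⁶ simple assignments; 6 patterns meet a case, all of kind (L,R), each with exactly one such main,
`korbit/simple_enum2.py`). -/
theorem simple3_needs_ppMain (L1 R1 L2 R2 L3 R3 : CS)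
    (hs : (L1.simple && R1.simple && L2.simple && R2.simple && L3.simple && R3.simple) = true)
    (hc : closed3 L1 R1 L2 R2 L3 R3 = true) (hm : meetsK4 (spreads3 L1 R1 L2 R2 L3 R3) = true) :
    ppMain L1 R1 = true ∨ ppMain L2 R2 = true ∨ ppMain L3 R3 = true := by
  have H := simple3_pp_all
  simp only [List.all_eq_true] at H
  have := H L1 (CS.mem_all _) R1 (CS.mem_all _) L2 (CS.mem_all _) R2 (CS.mem_all _) L3 (CS.mem_all _) R3 (CS.mem_all _)
  simp only [hs, hc, hm, Bool.not_true, Bool.false_or, Bool.or_eq_true] at this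
  tauto

/-! §E. FRONTHOOD arithmetic (ADD-4 add-2, LEMMA F17 and THEOREM R₃).  In a live channel with e_C = 1 whose −t's ahead chord is −u
((R, χ = −1) or (L, χ = +1), i.e. c_C = +1), the −t f born at the main-event that ends an M-gap of length Δ satisfies, exactly:
gap₀ ≥ k₁(η/2)Δ (its +t predecessor g separated from M at speed ≥ k₁η/2 during the gap and f is born at M), the transit time T of f's single
ahead chord −u to g obeys T ≥ gap₀/(k₂η/2) (closing speed of (−u,+t) ≤ k₂η/2), during the transit the gap (f,g) grows at rate ≥ k₁u (mid-angle
difference −u), so gap₁ ≥ gap₀ + T·k₁u at g's event; afterwards f ∥ g until g dies AT P, and then f (front, S₀ = ∅) closes on P at speed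
≤ k₂η/2, so fronthood(f) ≥ gap₁/(k₂η/2).  Hence fronthood(f)·k₂²η ≥ k₁(k₂η + 2k₁u)·Δ, i.e. fronthood ≥ (K + 2K²u/η)Δ with K = k₁/k₂.
Fronthoods of one channel are pairwise disjoint in time (one front at a time; FIFO), so over a period they sum to ≤ Y; if BOTH channels of a
main are of this type, the two M-gap classes (those ending at B-events feed R, those ending at A-events feed L; together they tile the period,
a + b = Y) give (K + 2K²u/η)·Y ≤ 2Y — impossible when (2 − K)η < 2K²u (flat case K = 1: η < 2u, i.e. 5η < 2δ, which contains the whole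
p = 3 window 9η ≤ 2δ). No hypothesis c < 1 or c_u < 1 is needed for F17 itself. -/

/-- LEMMA F17 (fronthood lower bound) as pure arithmetic of the four kinematic inequalities (g0 = gap₀, T = transit, g1 = gap₁,
fr = fronthood, Δ = the M-gap). -/
theorem fronthood_lb {k1 k2 η u Δ g0 T g1 fr : ℝ} (hk1 : 0 ≤ k1) (hη : 0 < η) (hk2η : 0 < k2 * η) (hu : 0 ≤ u)
    (h0 : k1 * (η / 2) * Δ ≤ g0) (hT : 2 * g0 ≤ T * (k2 * η)) (hg1 : g0 + T * (k1 * u) ≤ g1)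
    (hfr : 2 * g1 ≤ fr * (k2 * η)) :
    k1 * (k2 * η + 2 * k1 * u) * Δ ≤ fr * k2 ^ 2 * η := by
  have hk1u : 0 ≤ k1 * u := mul_nonneg hk1 hu
  have h1 : 2 * g0 * (k1 * u) ≤ T * (k2 * η) * (k1 * u) := mul_le_mul_of_nonneg_right hT hk1u
  have h1b : (g0 + T * (k1 * u)) * (k2 * η) ≤ g1 * (k2 * η) := mul_le_mul_of_nonneg_right hg1 hk2η.le
  have h2 : g0 * (k2 * η) + 2 * g0 * (k1 * u) ≤ g1 * (k2 * η) := by nlinarith [h1, h1b]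
  have h3 : k1 * (η / 2) * Δ * (k2 * η + 2 * k1 * u) ≤ g0 * (k2 * η + 2 * k1 * u) :=
    mul_le_mul_of_nonneg_right h0 (by positivity)
  have h4 : 2 * g1 * (k2 * η) ≤ fr * (k2 * η) * (k2 * η) := mul_le_mul_of_nonneg_right hfr hk2η.le
  have h5 : k1 * (k2 * η + 2 * k1 * u) * Δ * η ≤ fr * k2 ^ 2 * η * η := by nlinarith [h2, h3, h4]
  exact le_of_mul_le_mul_right h5 hη

/-- THEOREM R₃ (arithmetic core): the two channels of one main cannot both be of FRONTHOOD type with e_C = 1 when (2 − K)η < 2K²u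
(multiplied out: 2k₂²η < k₁(k₂η + 2k₁u)): their fronthood sums SA, SB ≤ Y over the complementary M-gap classes a + b = Y are too long. -/
theorem no_ppMain_timing {k1 k2 η u Y a b SA SB : ℝ} (hη : 0 < η) (hY : 0 < Y) (hab : a + b = Y)
    (hA : k1 * (k2 * η + 2 * k1 * u) * a ≤ SA * k2 ^ 2 * η) (hB : k1 * (k2 * η + 2 * k1 * u) * b ≤ SB * k2 ^ 2 * η)
    (hSA : SA ≤ Y) (hSB : SB ≤ Y) (hsmall : 2 * k2 ^ 2 * η < k1 * (k2 * η + 2 * k1 * u)) : False := by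
  have hk : 0 ≤ k2 ^ 2 * η := by positivity
  have h1 : SA * k2 ^ 2 * η ≤ Y * k2 ^ 2 * η := by nlinarith
  have h2 : SB * k2 ^ 2 * η ≤ Y * k2 ^ 2 * η := by nlinarith
  have h3 : k1 * (k2 * η + 2 * k1 * u) * Y ≤ 2 * (Y * k2 ^ 2 * η) := by nlinarith
  nlinarith

/-- Flat case k₁ = k₂ = 1 of the threshold: the whole p = 3 K4′-window 9η ≤ 2δ (from d + t + 4u ≥ 4δ) satisfies η < 2u, u = δ − 2η. -/
theorem threshold_flat {δ η : ℝ} (h : 9 * η ≤ 2 * δ) (hη : 0 < η) :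
    2 * (1:ℝ) ^ 2 * η < 1 * (1 * η + 2 * 1 * (δ - 2 * η)) := by nlinarith

end Summit.NavierStokesRegularity.FunctionalMining.TwoNotch
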